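import Literature.MathematicalPhysics.QuantumFieldTheory.Balaban1983to89.B7Ineq148Seam
import Literature.MathematicalPhysics.QuantumLattice.BalabanRGMultiscale

/-!
# `Balaban1983to89.B7BlockGeometry` — B7 = T. Bałaban, *Averaging operations for lattice gauge
# theories*, Commun. Math. Phys. **98**, 17–51 (1985): the operator facts of pp. 39–40 for the
# linear averaging operators `Q_k` ((139), [2] (1.11)) and `Q″_k` ((140), (141)) PROVED on the
# concrete block geometry of `ℤ^d`, and the hypothesis structure `B7Prop5Induction.OpFacts`
# DISCHARGED by name

CITATION HEADER (lean-in-tree rule 2026-08-18).  Bib key `Balaban1985Averaging`; held PDF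
`paper:balaban1985-cmp98-averaging` (journal page = PDF page + 16); renders read as images for this module by
unit b2b-balaban-b07-g4 (pub-balaban PAPER SUB-CELL B07 gen 4, 2026-08-18): `…/1985-cmp98-averaging-p001-x2.png`
(p. 17: (1)–(3)), `p002-x2` (p. 18: bonds), `p023-x2` (p. 39: (139)–(143)), `p024-x2` (p. 40: (144)–(147));
and of [2] = B5 = T. Bałaban, *Propagators and renormalization transformations for lattice gauge theories. I*,
Commun. Math. Phys. **95**, 17–40 (1984), bib key `Balaban1984PropagatorsI`, render
`…/1984-cmp95-propagators-rt-I-p003-x2.png` (p. 19: (1.8), (1.11)).  SIBLING of the landed modules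
`…B7Prop5Induction` (unit pv19: the induction (143)–(146), (149)–(155) over ABSTRACT positive operators, the
printed operator facts entering as the HYPOTHESIS STRUCTURE `OpFacts d κ Qj Qj'' Q Q'' Qj1 Qj1''` — its
docstring: "All fields are hypotheses — finite block-geometry facts the paper states without proof") and
`…B7Ineq148Seam` (unit b07-g3: (140) as the operator `QppOp L d S` over an abstract bond-set map `S`), and of
the tree's `ℤ^d` block vocabulary `QuantumLattice.BalabanRG` / `BalabanRGMultiscale` (prelude A18:
`blockMap M x = ⌊x/M⌋`, `blockSites M y`, `mem_blockSites_iff`, `card_blockSites`).  Nothing landed is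
edited or restated; all four are imported and used by name.

WHAT IS REPRODUCED (verbatim).  p. 17 [PDF 1], (2): *"For a point y ∈ L^nηZ^d (or any lattice δZ^d), we
define a block of an order j as the cube B^j(y) = {x ∈ L^{-j}L^nηZ^d : y_μ ≦ x_μ < y_μ + L^nη, μ = 1, …, d}"*
— corner cubes; in units of the fine spacing this is `⌊x/L^j⌋ = y` coordinatewise, i.e. the tree's
`x ∈ blockSites (L^j) y ↔ blockMap (L^j) x = y`.  p. 18 [PDF 2]: *"Bonds of the lattice Ω are ordered pairs
⟨x, x'⟩ of nearest neighbor points … b denotes a bond ⟨b₋, b₊⟩"*; here a (positively oriented) bond is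
`(x, μ) = ⟨x, x + e_μ⟩ : ZdEdge d`, and *"b ⊂ X"* (both endpoints in `X`) is `bondsIn X`.
[2] p. 19 [PDF 3], (1.11): *"(QA)_c = Σ_{x∈B(c₋)} L^{-(d+1)} A([x, x(c)])"*, with (1.8) *"where
A(Γ) = Σ_{b⊂Γ} A_b for arbitrary contour Γ, and x(c) denotes a point in the block B(c₊) obtained by
translation of x by the bond c, so if c = ⟨y, y + Le_μ⟩ then x(c) = x + Le_μ"* — typed as `Qav L`
(block size `L`; the straight contour `[x, x + Le_μ]` is the `L` bonds `(x + l e_μ, μ)`, `l < L`).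
p. 39 [PDF 23], (139): *"|Q_{V₀}A| ≦ Q|A|, … where the operator Q is defined as in [2], and Q″ is defined as
(Q″A)_c = Σ_{b⊂B(c₋)∪B(c₊)} L^{-d} A_b. (140) … A composition of k operators Q is the operator Q_k. The
operators Q″ do not compose in a simple way, but if we introduce an operator Q″_k by the formula
(Q″_k A)_c = Σ_{b⊂B^k(c₋)∪B^k(c₊)} η^d A_b, c ⊂ Ω^{(k)}, (141) then we have the inequality
|Q″Q″_j A| ≦ Q″Q″_j|A| ≦ 2dQ″_{j+1}|A|. (142)"*.  p. 40 [PDF 24], after (144): *"Further using the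
inequalities (142), QQ″_j|A| ≦ 2Q″_{j+1}|A|, and Q″Q_j|A| ≦ Q″_{j+1}|A|, we get"* (145); and (146):
*"|Q_k(U₀)A| ≦ Q_k|A| + 2C′₁α₀Q″_k|A| ≦ (1 + 2C′₁α₀)Q″_k|A|"*, whose second step is `Q_k|A| ≦ Q″_k|A|`.

SCALED COORDINATES.  Every lattice `L^{-j}…ℤ^d` is identified with `ℤ^d` (integer coordinates in units
of its own spacing), so an operator from the bonds of a lattice to the bonds of the `M`-times coarser
lattice is a linear map `(ZdEdge d → ℝ) →ₗ[ℝ] (ZdEdge d → ℝ)` indexed by the RATIO `M` alone: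
`Q_k = Qav (L^k)` (weight `L^{-k(d+1)} = (M^(d+1))⁻¹`), `Q″_k = Qdd (L^k)` (weight `η^d = (M^d)⁻¹` in
units where the coarse spacing is `1`), `Q = Qav L`, `Q″ = Qdd L`; "a composition of k operators Q is Q_k"
becomes `Qav K ∘ Qav M = Qav (M K)`.

WHAT IS PROVED (0 sorry; [folklore] = finite counting on `ℤ^d`, the content the paper leaves to the reader):
* `Qav`, `Qdd` (= `B7Ineq148Seam.QppOp (M : ℝ) d (qppBonds M)`, so the (148)-seam composes by name),
  their monotonicity, `Qav M 1 = 1`, `#qppBonds ≤ 2d·M^d`;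
* `Qav_Qav` : `Qav K (Qav M f) = Qav (M * K) f` — "a composition of k operators Q is the operator Q_k";
* `Qav_le_Qdd` : `Qav M |A| ≤ Qdd M |A|` — the step `Q_k|A| ≦ Q″_k|A|` of (146) (each straight line of
  `M` bonds lies in `B^k(c₋) ∪ B^k(c₊)`, multiplicity `≤ M`, `M · M^{-(d+1)} = M^{-d}`);
* `Qdd_Qav_le` : `Qdd K (Qav M |A|) ≤ Qdd (M K) |A|` — p. 40 `Q″Q_j|A| ≦ Q″_{j+1}|A|`;
* `Qdd_Qdd_le` : `Qdd K (Qdd M |A|) ≤ 2d • Qdd (M K) |A|` — (142) (a fine bond `b` with level-`M` block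
  index `w` is counted only from the `≤ 2d` unit bonds `(w, ν)`, `(w − e_ν, ν)`);
* `Qav_Qdd_le` : `Qav K (Qdd M |A|) ≤ (2 − K⁻¹) • Qdd (M K) |A|` — p. 40 `QQ″_j|A| ≦ 2Q″_{j+1}|A|` with the
  SHARP multiplicity `2K − 1` (of the `2K` candidate pairs `(w − l e_μ, l)`, `(w − (l+1) e_μ, l)` the two
  extreme ones `(w, 0)`, `(w − K e_μ, K − 1)` cannot both lie in the block `B(y)`), which is the constant
  `κ = 2 − L⁻¹` that line 2 of (154) needs (`B7Prop5Induction.kappa_two_no_room`: `κ = 2` leaves no room);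
* `opFacts_lattice` : for `1 ≤ L` and every `j`,
  `OpFacts (d : ℝ) (2 − L⁻¹) (Qav (L^j)) (Qdd (L^j)) (Qav L) (Qdd L) (Qav (L^(j+1))) (Qdd (L^(j+1)))` —
  EVERY field of pv19's hypothesis structure discharged on the printed geometry, hence (`opFacts_of_kappa_le`)
  also with the printed `κ = 2` (`opFacts_lattice_two`), and `qk_le_qddk` = the hypothesis `hQk` of
  `B7Prop5Induction.ineq146`.
* § 6, BY-NAME COMPOSITION: `ineq143_succ_lattice`, `ineq146_lattice`, `ineq149_succ_lattice` = the
  sibling's `ineq143_succ` / `ineq146` / `ineq149_succ` with `OpFacts` / `hQk` supplied by this module.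
So, after this module, the remaining HYPOTHESES of the (143)/(149)-induction in `B7Prop5Induction` are the
analytic inputs only ((139) second half = Prop. 2, (148) via `B7Ineq148Seam`, (135), the chain rule (153),
`Hyp154`): the block-geometry bookkeeping is kernel-checked.

DIVERGENCE (recorded, not silent).  (i) Carrier: B7 works on finite tori/boxes `Ω ⊂ ηℤ^d` with
`B^j(Ω^{(j)}) = Ω` ((4)); here the operators act on ALL of `ℤ^d` (scaled integer coordinates, free
boundary), exactly the setting of the tree's prelude `BalabanRG`; on a union of blocks the printed sums are
the same finite sums, so the inequalities restrict verbatim.  (ii) (139)'s `Q` for vector fields is [2]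
(1.11) (straight contours `[x, x(c)]`), as the paper says ("defined as in [2]"); B7's own non-linear
averaging (15)/(42) is not involved in these linear facts.  (iii) `|A|` is the bond function `b ↦ |A_b|`;
all inequalities are stated for arbitrary non-negative bond functions `f ≥ 0`.
VALUE = kernel certificate of printed finite counting facts (the paper's "then we have the inequality"),
discharging a hypothesis structure of a landed sibling BY NAME; NOT summit progress.
-/

noncomputable section

namespace Literature.MathematicalPhysics.QuantumFieldTheory.Balaban1983to89.B7BlockGeometry

open Finset
open Literature.MathematicalPhysics.QuantumLattice (ZdEdge blockMap blockSites mem_blockSites_iff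
  card_blockSites)
open Literature.MathematicalPhysics.QuantumFieldTheory.Balaban1983to89.B7Ineq148Seam (QppOp QppOp_apply
  QppOp_monotone)
open Literature.MathematicalPhysics.QuantumFieldTheory.Balaban1983to89.B7Prop5Induction (OpFacts
  apply_nonneg)

variable {d : ℕ}

/-! ## 1. Floor-division block geometry on `ℤ^d` (complements to `QuantumLattice.BalabanRG`) -/

/-- Coordinate formula of the block map `x ↦ ⌊x/M⌋`. [folklore] -/
theorem blockMap_apply (M : ℕ) (x : Fin d → ℤ) (i : Fin d) : blockMap M x i = x i / (M : ℤ) := rfl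

/-- Nested blocks, p. 17 (3): the block index at scale `M K` is the scale-`K` block index of the scale-`M`
block index (`⌊⌊x/M⌋/K⌋ = ⌊x/(MK)⌋`; cf. `QuantumLattice.coarseEdge_coarseEdge`). [folklore] -/
theorem blockMap_blockMap (M K : ℕ) (x : Fin d → ℤ) :
    blockMap K (blockMap M x) = blockMap (M * K) x := by
  funext i
  simp only [blockMap_apply, Nat.cast_mul]
  exact Int.ediv_ediv_of_nonneg (Int.natCast_nonneg M)

/-- Translating by `M t e_μ` shifts the scale-`M` block index by `t e_μ`. [folklore] -/
theorem blockMap_add_single_mul (M : ℕ) (hM : M ≠ 0) (x : Fin d → ℤ) (μ : Fin d) (t : ℤ) :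
    blockMap M (x + Pi.single μ ((M : ℤ) * t)) = blockMap M x + Pi.single μ t := by
  have hMz : (M : ℤ) ≠ 0 := by exact_mod_cast hM
  funext i
  by_cases hi : i = μ
  · subst hi
    simp only [blockMap_apply, Pi.add_apply, Pi.single_eq_same]
    exact Int.add_mul_ediv_left _ _ hMz
  · simp only [blockMap_apply, Pi.add_apply, Pi.single_eq_of_ne hi, add_zero]

/-- The block index of `x + l e_μ`, `0 ≤ l ≤ M`, is that of `x` or its `e_μ`-neighbour (the straight
contour `[x, x + Me_μ]` of [2] (1.8) stays in `B(c₋) ∪ B(c₊)`). [folklore] -/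
theorem blockMap_add_single_eq_or (M : ℕ) (hM : 0 < M) (x : Fin d → ℤ) (μ : Fin d) {l : ℤ}
    (h0 : 0 ≤ l) (hl : l ≤ M) :
    blockMap M (x + Pi.single μ l) = blockMap M x ∨
      blockMap M (x + Pi.single μ l) = blockMap M x + Pi.single μ 1 := by
  have hMz : (0 : ℤ) < M := by exact_mod_cast hM
  have h1 : (M : ℤ) * (x μ / M) ≤ x μ := Int.mul_ediv_self_le hMz.ne'
  have h2 : x μ < M * (x μ / M) + M := Int.lt_mul_ediv_self_add hMz
  have hq1 : x μ / M ≤ (x μ + l) / M := Int.le_ediv_of_mul_le hMz (by linarith)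
  have hq2 : (x μ + l) / M < x μ / M + 2 := Int.ediv_lt_of_lt_mul hMz (by linarith)
  have key : ∀ i, i ≠ μ → blockMap M (x + Pi.single μ l) i = blockMap M x i := fun i hi => by
    simp only [blockMap_apply, Pi.add_apply, Pi.single_eq_of_ne hi, add_zero]
  have keyμ : blockMap M (x + Pi.single μ l) μ = (x μ + l) / M := by
    simp only [blockMap_apply, Pi.add_apply, Pi.single_eq_same]
  rcases (show (x μ + l) / M = x μ / M ∨ (x μ + l) / M = x μ / M + 1 by omega) with hq | hq
  · left
    funext i
    by_cases hi : i = μ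
    · subst hi; rw [keyμ, hq, blockMap_apply]
    · exact key i hi
  · right
    funext i
    by_cases hi : i = μ
    · subst hi; rw [Pi.add_apply, keyμ, hq, blockMap_apply, Pi.single_eq_same]
    · rw [Pi.add_apply, key i hi, Pi.single_eq_of_ne hi, add_zero]

/-- A translate of a block is a block: `B_M(x' + t e_μ) = B_M(x') + M t e_μ`. [folklore] -/
theorem blockSites_add_single (M : ℕ) (hM : 0 < M) (x' : Fin d → ℤ) (μ : Fin d) (t : ℤ) :
    blockSites M (x' + Pi.single μ t) =
      (blockSites M x').image (fun z => z + Pi.single μ ((M : ℤ) * t)) := by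
  haveI : NeZero M := ⟨hM.ne'⟩
  ext s
  simp only [Finset.mem_image, mem_blockSites_iff]
  constructor
  · intro hs
    refine ⟨s - Pi.single μ ((M : ℤ) * t), ?_, sub_add_cancel _ _⟩
    have h := blockMap_add_single_mul M hM.ne' (s - Pi.single μ ((M : ℤ) * t)) μ t
    rw [sub_add_cancel, hs] at h
    exact (add_right_cancel h).symm
  · rintro ⟨z, hz, rfl⟩
    rw [blockMap_add_single_mul M hM.ne', hz]

/-- Sums over a translated block. [folklore] -/
theorem sum_blockSites_add_single {β : Type*} [AddCommMonoid β] (M : ℕ) (hM : 0 < M)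
    (x' : Fin d → ℤ) (μ : Fin d) (t : ℤ) (F : (Fin d → ℤ) → β) :
    ∑ s ∈ blockSites M (x' + Pi.single μ t), F s =
      ∑ z ∈ blockSites M x', F (z + Pi.single μ ((M : ℤ) * t)) := by
  rw [blockSites_add_single M hM, Finset.sum_image]
  intro z _ z' _ h
  exact add_right_cancel h

/-- p. 17 (3)–(4), nested blocks: `B_{MK}(y)` is the disjoint union of the `B_M(x')`, `x' ∈ B_K(y)`.
[folklore] -/
theorem blockSites_mul_eq_biUnion (M K : ℕ) (hM : 0 < M) (hK : 0 < K) (y : Fin d → ℤ) :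
    blockSites (M * K) y = (blockSites K y).biUnion (fun x' => blockSites M x') := by
  haveI : NeZero M := ⟨hM.ne'⟩
  haveI : NeZero K := ⟨hK.ne'⟩
  haveI : NeZero (M * K) := ⟨(Nat.mul_pos hM hK).ne'⟩
  ext z
  simp only [Finset.mem_biUnion, mem_blockSites_iff, ← blockMap_blockMap M K]
  constructor
  · intro h
    exact ⟨blockMap M z, h, rfl⟩
  · rintro ⟨x', hx', h⟩
    rw [h]
    exact hx'

/-- Sums over `B_{MK}(y)` block by block. [folklore] -/
theorem sum_blockSites_mul {β : Type*} [AddCommMonoid β] (M K : ℕ) (hM : 0 < M) (hK : 0 < K)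
    (y : Fin d → ℤ) (F : (Fin d → ℤ) → β) :
    ∑ z ∈ blockSites (M * K) y, F z = ∑ x' ∈ blockSites K y, ∑ z ∈ blockSites M x', F z := by
  haveI : NeZero M := ⟨hM.ne'⟩
  rw [blockSites_mul_eq_biUnion M K hM hK, Finset.sum_biUnion]
  intro x₁ _ x₂ _ hne
  simp only [Function.onFun]
  rw [Finset.disjoint_left]
  intro z hz₁ hz₂
  rw [mem_blockSites_iff] at hz₁ hz₂
  exact hne (hz₁.symm.trans hz₂)

/-- A straight contour of `M K` bonds is `K` consecutive contours of `M` bonds. [folklore] -/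
theorem sum_range_mul_eq {β : Type*} [AddCommMonoid β] (F : ℕ → β) (M K : ℕ) :
    ∑ n ∈ Finset.range (M * K), F n =
      ∑ l' ∈ Finset.range K, ∑ l ∈ Finset.range M, F (l' * M + l) := by
  induction K with
  | zero => simp
  | succ K ih =>
    rw [Nat.mul_succ, Finset.sum_range_add, ih, Finset.sum_range_succ]
    congr 1
    exact Finset.sum_congr rfl fun l _ => by rw [Nat.mul_comm K M]

/-- The bonds `b ⊂ X` (p. 18: both endpoints `b₋ = x`, `b₊ = x + e_μ` in `X`). [folklore] -/
def bondsIn (X : Finset (Fin d → ℤ)) : Finset (ZdEdge d) :=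
  (X ×ˢ (Finset.univ : Finset (Fin d))).filter fun b => b.1 + Pi.single b.2 1 ∈ X

/-- Membership in `bondsIn`. [folklore] -/
theorem mem_bondsIn {X : Finset (Fin d → ℤ)} {b : ZdEdge d} :
    b ∈ bondsIn X ↔ b.1 ∈ X ∧ b.1 + Pi.single b.2 1 ∈ X := by
  simp only [bondsIn, Finset.mem_filter, Finset.mem_product, Finset.mem_univ, and_true]

/-- At most `d · #X` bonds have both endpoints in `X`. [folklore] -/
theorem card_bondsIn_le (X : Finset (Fin d → ℤ)) : (bondsIn X).card ≤ X.card * d :=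
  (Finset.card_le_card (Finset.filter_subset _ _)).trans
    (by rw [Finset.card_product, Finset.card_univ, Fintype.card_fin])

/-- `B^k(c₋) ∪ B^k(c₊)` for the coarse bond `c = (y, μ) = ⟨y, y + e_μ⟩` at ratio `M = L^k` ((140), (141)).
[cite: Balaban1985Averaging, (141) p.39] -/
def twoBlocks (M : ℕ) (c : ZdEdge d) : Finset (Fin d → ℤ) :=
  blockSites M c.1 ∪ blockSites M (c.1 + Pi.single c.2 1)

/-- Membership in `B(c₋) ∪ B(c₊)` through the block index. [folklore] -/
theorem mem_twoBlocks_iff (M : ℕ) [NeZero M] {c : ZdEdge d} {s : Fin d → ℤ} :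
    s ∈ twoBlocks M c ↔ blockMap M s = c.1 ∨ blockMap M s = c.1 + Pi.single c.2 1 := by
  rw [twoBlocks, Finset.mem_union, mem_blockSites_iff, mem_blockSites_iff]

/-- The index set of (141): the bonds `b ⊂ B^k(c₋) ∪ B^k(c₊)` ((140) is `k = 1`).
[cite: Balaban1985Averaging, (140)-(141) p.39] -/
def qppBonds (M : ℕ) (c : ZdEdge d) : Finset (ZdEdge d) := bondsIn (twoBlocks M c)

/-- Membership in the index set of (141). [folklore] -/
theorem mem_qppBonds (M : ℕ) {c b : ZdEdge d} :
    b ∈ qppBonds M c ↔ b.1 ∈ twoBlocks M c ∧ b.1 + Pi.single b.2 1 ∈ twoBlocks M c :=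
  mem_bondsIn

/-- `#{b ⊂ B^k(c₋) ∪ B^k(c₊)} ≤ 2d M^d` (so `Q″_k 1 ≤ 2d`). [folklore] -/
theorem card_qppBonds_le (M : ℕ) (c : ZdEdge d) : (qppBonds M c).card ≤ 2 * M ^ d * d := by
  calc (qppBonds M c).card ≤ (twoBlocks M c).card * d := card_bondsIn_le _
    _ ≤ (M ^ d + M ^ d) * d := by
        apply Nat.mul_le_mul_right
        exact (Finset.card_union_le _ _).trans (by rw [card_blockSites, card_blockSites])
    _ = 2 * M ^ d * d := by ring

/-- Refinement: if the scale-`M` block index of `s` lies in `B_K(y) ∪ B_K(y + e_μ)`, then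
`s ∈ B_{MK}(y) ∪ B_{MK}(y + e_μ)` (nested blocks, p. 17 (3)). [folklore] -/
theorem mem_twoBlocks_mul {M K : ℕ} (hM : 0 < M) (hK : 0 < K) {c : ZdEdge d} {s : Fin d → ℤ}
    (h : blockMap M s ∈ twoBlocks K c) : s ∈ twoBlocks (M * K) c := by
  haveI : NeZero K := ⟨hK.ne'⟩
  haveI : NeZero (M * K) := ⟨(Nat.mul_pos hM hK).ne'⟩
  rw [mem_twoBlocks_iff] at h ⊢
  rwa [← blockMap_blockMap]

/-- Refinement of the (141) index sets: if both endpoints of the unit bond `c'` lie in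
`B_K(c₋) ∪ B_K(c₊)`, then every `b ⊂ B_M(c'₋) ∪ B_M(c'₊)` satisfies `b ⊂ B_{MK}(c₋) ∪ B_{MK}(c₊)`. [folklore] -/
theorem qppBonds_subset_mul {M K : ℕ} (hM : 0 < M) (hK : 0 < K) {c c' : ZdEdge d}
    (h1 : c'.1 ∈ twoBlocks K c) (h2 : c'.1 + Pi.single c'.2 1 ∈ twoBlocks K c) :
    qppBonds M c' ⊆ qppBonds (M * K) c := by
  haveI : NeZero M := ⟨hM.ne'⟩
  intro b hb
  rw [mem_qppBonds] at hb ⊢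
  have lift : ∀ s ∈ twoBlocks M c', s ∈ twoBlocks (M * K) c := fun s hs => by
    refine mem_twoBlocks_mul hM hK ?_
    rcases (mem_twoBlocks_iff M).1 hs with h | h
    · rw [h]; exact h1
    · rw [h]; exact h2
  exact ⟨lift _ hb.1, lift _ hb.2⟩

/-- The sites `x + l e_μ`, `0 ≤ l ≤ K`, of the straight contour from `x ∈ B_K(y)` lie in
`B_K(y) ∪ B_K(y + e_μ)` ([2] (1.8): `x(c) = x + Le_μ ∈ B(c₊)`). [folklore] -/
theorem line_mem_twoBlocks {K : ℕ} (hK : 0 < K) {y x : Fin d → ℤ} (μ : Fin d)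
    (hx : x ∈ blockSites K y) {l : ℤ} (h0 : 0 ≤ l) (hl : l ≤ K) :
    x + Pi.single μ l ∈ twoBlocks K (y, μ) := by
  haveI : NeZero K := ⟨hK.ne'⟩
  rw [mem_blockSites_iff] at hx
  rw [mem_twoBlocks_iff]
  rcases blockMap_add_single_eq_or K hK x μ h0 hl with h | h
  · left; rw [h, hx]
  · right; rw [h, hx]

/-! ## 2. Double counting: a sum with bounded multiplicities -/

/-- If `ψ` maps `D` into `T` with fibres of size `≤ m` and `g ≥ 0` on `T`, then
`Σ_{p∈D} g(ψ p) ≤ m · Σ_{b∈T} g b`. [folklore] -/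
theorem sum_le_card_mul_sum {ι β : Type*} [DecidableEq β] (D : Finset ι) (ψ : ι → β)
    (T : Finset β) (g : β → ℝ) (m : ℕ) (hT : ∀ p ∈ D, ψ p ∈ T)
    (hm : ∀ b ∈ T, (D.filter fun p => ψ p = b).card ≤ m) (hg : ∀ b ∈ T, 0 ≤ g b) :
    ∑ p ∈ D, g (ψ p) ≤ m * ∑ b ∈ T, g b := by
  rw [← Finset.sum_fiberwise_of_maps_to hT, Finset.mul_sum]
  refine Finset.sum_le_sum fun b hb => ?_
  calc ∑ p ∈ D.filter (fun p => ψ p = b), g (ψ p) = ∑ p ∈ D.filter (fun p => ψ p = b), g b :=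
        Finset.sum_congr rfl fun p hp => by rw [(Finset.mem_filter.1 hp).2]
    _ = ((D.filter fun p => ψ p = b).card : ℝ) * g b := by rw [Finset.sum_const, nsmul_eq_mul]
    _ ≤ m * g b := mul_le_mul_of_nonneg_right (by exact_mod_cast hm b hb) (hg b hb)

/-- Two-level form of `sum_le_card_mul_sum` (outer index `a ∈ C`, inner index `i ∈ I a`, summand
`g (φ a i)`), fibres counted on `C.sigma I`. [folklore] -/
theorem sum_sum_le_card_mul_sum {α γ β : Type*} [DecidableEq β] (C : Finset α) (I : α → Finset γ)
    (φ : α → γ → β) (T : Finset β) (g : β → ℝ) (m : ℕ)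
    (hT : ∀ a ∈ C, ∀ i ∈ I a, φ a i ∈ T)
    (hm : ∀ b ∈ T, ((C.sigma I).filter fun p => φ p.1 p.2 = b).card ≤ m)
    (hg : ∀ b ∈ T, 0 ≤ g b) :
    ∑ a ∈ C, ∑ i ∈ I a, g (φ a i) ≤ m * ∑ b ∈ T, g b := by
  have h := sum_le_card_mul_sum (C.sigma I) (fun p => φ p.1 p.2) T g m
    (fun p hp => hT p.1 (Finset.mem_sigma.1 hp).1 p.2 (Finset.mem_sigma.1 hp).2) hm hg
  rwa [Finset.sum_sigma] at h

/-! ## 3. The operators `Q_k` ([2] (1.11), (139)) and `Q″_k` ((140), (141)) -/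

/-- [2] (1.11) / (139): the linear block averaging of a bond function at ratio `M = L^k`,
`(Q_k f)(y, μ) = Σ_{x ∈ B^k(y)} Σ_{l<M} M^{-(d+1)} f(x + l e_μ, μ)` (sum over the straight contours
`[x, x + Me_μ]`).  [cite: Balaban1984PropagatorsI, (1.11) p.19] [cite: Balaban1985Averaging, (139) p.39] -/
def Qav (M : ℕ) : (ZdEdge d → ℝ) →ₗ[ℝ] (ZdEdge d → ℝ) where
  toFun f c := ∑ x ∈ blockSites M c.1, ∑ l ∈ Finset.range M,
    ((M : ℝ) ^ (d + 1))⁻¹ * f (x + Pi.single c.2 (l : ℤ), c.2)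
  map_add' f g := by
    ext c
    simp only [Pi.add_apply, mul_add, Finset.sum_add_distrib]
  map_smul' a f := by
    ext c
    simp only [Pi.smul_apply, smul_eq_mul, RingHom.id_apply, Finset.mul_sum]
    exact Finset.sum_congr rfl fun x _ => Finset.sum_congr rfl fun l _ => by ring

/-- Unfolding of `Qav` = [2] (1.11). [folklore] -/
@[simp] theorem Qav_apply (M : ℕ) (f : ZdEdge d → ℝ) (c : ZdEdge d) :
    Qav M f c = ∑ x ∈ blockSites M c.1, ∑ l ∈ Finset.range M,
      ((M : ℝ) ^ (d + 1))⁻¹ * f (x + Pi.single c.2 (l : ℤ), c.2) := rfl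

/-- `Qav` as one weighted sum over the pairs `(x, l)`. [folklore] -/
theorem Qav_apply_prod (M : ℕ) (f : ZdEdge d → ℝ) (c : ZdEdge d) :
    Qav M f c = ((M : ℝ) ^ (d + 1))⁻¹ *
      ∑ p ∈ blockSites M c.1 ×ˢ Finset.range M, f (p.1 + Pi.single c.2 (p.2 : ℤ), c.2) := by
  rw [Qav_apply, Finset.sum_product, Finset.mul_sum]
  simp_rw [Finset.mul_sum]

/-- (141) (and (140) for `k = 1`): `(Q″_k f)_c = Σ_{b ⊂ B^k(c₋) ∪ B^k(c₊)} M^{-d} f_b`, literally the sibling's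
`B7Ineq148Seam.QppOp` with the concrete index sets `qppBonds M`. [cite: Balaban1985Averaging, (141) p.39] -/
def Qdd (M : ℕ) : (ZdEdge d → ℝ) →ₗ[ℝ] (ZdEdge d → ℝ) := QppOp (M : ℝ) d (qppBonds M)

/-- Unfolding of `Qdd` = (141). [folklore] -/
@[simp] theorem Qdd_apply (M : ℕ) (f : ZdEdge d → ℝ) (c : ZdEdge d) :
    Qdd M f c = ∑ b ∈ qppBonds M c, ((M : ℝ) ^ d)⁻¹ * f b := rfl

/-- `Qdd` as one weighted sum. [folklore] -/
theorem Qdd_apply' (M : ℕ) (f : ZdEdge d → ℝ) (c : ZdEdge d) :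
    Qdd M f c = ((M : ℝ) ^ d)⁻¹ * ∑ b ∈ qppBonds M c, f b := by
  rw [Qdd_apply, Finset.mul_sum]

/-- `Q_k` is a positive operator (field `OpFacts.monoQj/monoQ/monoQj1`). [folklore] -/
theorem Qav_monotone (M : ℕ) : Monotone (Qav (d := d) M) := by
  intro f g hfg c
  simp only [Qav_apply]
  exact Finset.sum_le_sum fun x _ => Finset.sum_le_sum fun l _ =>
    mul_le_mul_of_nonneg_left (hfg _) (inv_nonneg.2 (pow_nonneg (Nat.cast_nonneg M) _))

/-- `Q″_k` is a positive operator (field `OpFacts.monoQj''/monoQ''/monoQj1''`). [folklore] -/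
theorem Qdd_monotone (M : ℕ) : Monotone (Qdd (d := d) M) :=
  QppOp_monotone (Nat.cast_nonneg M) d _

/-- A weight identity: `M^{-(n+1)} · M = M^{-n}`. [folklore] -/
private theorem inv_pow_succ_mul (M : ℝ) (hM : M ≠ 0) (n : ℕ) (S : ℝ) :
    (M ^ (n + 1))⁻¹ * (M * S) = (M ^ n)⁻¹ * S := by
  rw [pow_succ, mul_inv, mul_assoc, inv_mul_cancel_left₀ hM]

/-- `Q_k` is an average: `Q_k c = c` on constants (`#B^k(y) · M · M^{-(d+1)} = 1`). [folklore] -/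
theorem Qav_const (M : ℕ) (hM : 0 < M) (a : ℝ) (c : ZdEdge d) : Qav M (fun _ => a) c = a := by
  have hMr : (M : ℝ) ≠ 0 := by exact_mod_cast hM.ne'
  rw [Qav_apply, Finset.sum_const, Finset.sum_const, Finset.card_range, card_blockSites]
  simp only [nsmul_eq_mul, Nat.cast_pow]
  have h : (M : ℝ) * (M : ℝ)⁻¹ = 1 := mul_inv_cancel₀ hMr
  rw [pow_succ, mul_inv]
  linear_combination (a * ((M : ℝ) ^ d * ((M : ℝ) ^ d)⁻¹)) * h +
    a * mul_inv_cancel₀ (pow_ne_zero d hMr)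

/-- `Q_j|A| ≤ sup |A|` (field `OpFacts.qj_le_sup`, used in line 3 of (154)). [folklore] -/
theorem Qav_le_of_le (M : ℕ) (hM : 0 < M) {f : ZdEdge d → ℝ} {a : ℝ} (hf : ∀ b, f b ≤ a)
    (c : ZdEdge d) : Qav M f c ≤ a :=
  (Qav_monotone M (fun b => hf b) c).trans_eq (Qav_const M hM a c)

/-- `Q″_j|A| ≤ 2d · sup |A|` (field `OpFacts.qj''_le_sup`: `Q″_j 1 ≤ 2d` by (141)). [folklore] -/
theorem Qdd_le_of_le (M : ℕ) (hM : 0 < M) {f : ZdEdge d → ℝ} {a : ℝ} (ha : 0 ≤ a)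
    (hf : ∀ b, f b ≤ a) (c : ZdEdge d) : Qdd M f c ≤ 2 * d * a := by
  have hP : (0 : ℝ) < (M : ℝ) ^ d := pow_pos (by exact_mod_cast hM) d
  have h : (M : ℝ) ^ d * ((M : ℝ) ^ d)⁻¹ = 1 := mul_inv_cancel₀ hP.ne'
  calc Qdd M f c ≤ Qdd M (fun _ => a) c := Qdd_monotone M (fun b => hf b) c
    _ = (qppBonds M c).card * (((M : ℝ) ^ d)⁻¹ * a) := by
        rw [Qdd_apply, Finset.sum_const, nsmul_eq_mul]
    _ ≤ ((2 * M ^ d * d : ℕ) : ℝ) * (((M : ℝ) ^ d)⁻¹ * a) :=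
        mul_le_mul_of_nonneg_right (by exact_mod_cast card_qppBonds_le M c)
          (mul_nonneg (inv_nonneg.2 hP.le) ha)
    _ = 2 * d * a := by
        push_cast
        linear_combination (2 * d * a) * h

/-! ## 4. The printed operator facts, proved -/

/-- p. 39 [PDF 23]: *"A composition of k operators Q is the operator Q_k"* — `Q_K ∘ Q_M = Q_{MK}` (the
`K` straight contours of `M` fine bonds through the translates `B_M(x') + M l' e_μ` concatenate to the straight
contour of `M K` bonds; [2] (1.8)).  [cite: Balaban1985Averaging, p.39 after (140)] -/
theorem Qav_Qav (M K : ℕ) (hM : 0 < M) (hK : 0 < K) (f : ZdEdge d → ℝ) :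
    Qav K (Qav M f) = Qav (M * K) f := by
  funext c
  obtain ⟨y, μ⟩ := c
  simp only [Qav_apply]
  rw [sum_blockSites_mul M K hM hK]
  refine Finset.sum_congr rfl fun x' _ => ?_
  simp_rw [sum_blockSites_add_single M hM, sum_range_mul_eq _ M K]
  conv_rhs => rw [Finset.sum_comm]
  refine Finset.sum_congr rfl fun l' _ => ?_
  rw [Finset.mul_sum]
  refine Finset.sum_congr rfl fun z _ => ?_
  rw [Finset.mul_sum]
  refine Finset.sum_congr rfl fun l _ => ?_
  have hcast : (M : ℤ) * (l' : ℕ) + (l : ℕ) = ((l' * M + l : ℕ) : ℤ) := by push_cast; ring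
  rw [add_assoc, ← Pi.single_add, hcast, ← mul_assoc, Nat.cast_mul, mul_pow, mul_inv,
    mul_comm (((K : ℝ) ^ (d + 1))⁻¹)]

/-- p. 40 [PDF 24], the second step of (146): `Q_k|A| ≦ Q″_k|A|` (each of the `M` bonds of a straight
contour `[x, x + Me_μ]`, `x ∈ B^k(c₋)`, lies in `B^k(c₋) ∪ B^k(c₊)`, and a given fine bond lies on at most `M`
such contours: `M · M^{-(d+1)} = M^{-d}`) — the hypothesis `hQk` of `B7Prop5Induction.ineq146`.
[cite: Balaban1985Averaging, (146) p.40] -/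
theorem Qav_le_Qdd (M : ℕ) (hM : 0 < M) {f : ZdEdge d → ℝ} (hf : 0 ≤ f) : Qav M f ≤ Qdd M f := by
  haveI : NeZero M := ⟨hM.ne'⟩
  have hMr : (M : ℝ) ≠ 0 := by exact_mod_cast hM.ne'
  intro c
  obtain ⟨y, μ⟩ := c
  have key : ∑ x ∈ blockSites M y, ∑ l ∈ Finset.range M, f (x + Pi.single μ (l : ℤ), μ)
      ≤ M * ∑ b ∈ qppBonds M (y, μ), f b := by
    -- two-step application: instantiate the counting lemma first, then supply the two
    -- combinatorial facts (a one-step `refine` makes the unifier unfold the finite sets)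
    have h := sum_sum_le_card_mul_sum (blockSites M y) (fun _ => Finset.range M)
      (fun x l => (x + Pi.single μ (l : ℤ), μ)) (qppBonds M (y, μ)) f M
    refine h ?_ ?_ (fun b _ => hf b)
    · intro x hx l hl
      rw [Finset.mem_range] at hl
      rw [mem_qppBonds]
      refine ⟨line_mem_twoBlocks hM μ hx (by positivity) (by exact_mod_cast hl.le), ?_⟩
      dsimp only
      rw [add_assoc, ← Pi.single_add]
      exact line_mem_twoBlocks hM μ hx (by positivity) (by omega)
    · intro b _
      calc _ ≤ (Finset.range M).card :=
            Finset.card_le_card_of_injOn (fun p => p.2) ?_ ?_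
        _ = M := Finset.card_range M
      · intro p hp
        simp only [Finset.coe_filter, Finset.mem_sigma, Set.mem_setOf_eq] at hp
        exact Finset.mem_coe.2 hp.1.2
      · intro p hp p' hp' h
        simp only [Finset.coe_filter, Finset.mem_sigma, Set.mem_setOf_eq] at hp hp'
        have h' : p.2 = p'.2 := h
        have h3 := (Prod.ext_iff.1 (hp.2.trans hp'.2.symm)).1
        dsimp only at h3
        rw [h'] at h3
        exact Sigma.ext (add_right_cancel h3) (heq_of_eq h')
  calc Qav M f (y, μ)
      = ((M : ℝ) ^ (d + 1))⁻¹ *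
          ∑ x ∈ blockSites M y, ∑ l ∈ Finset.range M, f (x + Pi.single μ (l : ℤ), μ) := by
        rw [Qav_apply, Finset.mul_sum]; simp_rw [Finset.mul_sum]
    _ ≤ ((M : ℝ) ^ (d + 1))⁻¹ * (M * ∑ b ∈ qppBonds M (y, μ), f b) :=
        by gcongr
    _ = Qdd M f (y, μ) := by rw [inv_pow_succ_mul _ hMr, Qdd_apply']

/-- p. 40 [PDF 24] l. 9: `Q″Q_j|A| ≦ Q″_{j+1}|A|` (a fine bond `(x + l e_ν, ν)` on a contour of `Q_j` inside
the unit bond `c' ⊂ B(c₋) ∪ B(c₊)` lies in `B^{j+1}(c₋) ∪ B^{j+1}(c₊)`; it is reached from at most `M` pairs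
`(c', (x, l))`; weights `K^{-d} · M^{-(d+1)} · M = (MK)^{-d}`) — field `OpFacts.q''q`.
[cite: Balaban1985Averaging, p.40 l.9] -/
theorem Qdd_Qav_le (M K : ℕ) (hM : 0 < M) (hK : 0 < K) {f : ZdEdge d → ℝ} (hf : 0 ≤ f) :
    Qdd K (Qav M f) ≤ Qdd (M * K) f := by
  haveI : NeZero M := ⟨hM.ne'⟩
  haveI : NeZero K := ⟨hK.ne'⟩
  have hMr : (M : ℝ) ≠ 0 := by exact_mod_cast hM.ne'
  intro c
  have key : ∑ c' ∈ qppBonds K c, ∑ p ∈ blockSites M c'.1 ×ˢ Finset.range M,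
      f (p.1 + Pi.single c'.2 (p.2 : ℤ), c'.2) ≤ M * ∑ b ∈ qppBonds (M * K) c, f b := by
    have h := sum_sum_le_card_mul_sum (qppBonds K c) (fun c' => blockSites M c'.1 ×ˢ Finset.range M)
      (fun c' p => (p.1 + Pi.single c'.2 (p.2 : ℤ), c'.2)) (qppBonds (M * K) c) f M
    refine h ?_ ?_ (fun b _ => hf b)
    · intro c' hc' p hp
      rw [Finset.mem_product, Finset.mem_range] at hp
      rw [mem_qppBonds] at hc'
      refine qppBonds_subset_mul hM hK hc'.1 hc'.2 ?_
      rw [mem_qppBonds]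
      refine ⟨line_mem_twoBlocks hM c'.2 hp.1 (by positivity) (by exact_mod_cast hp.2.le), ?_⟩
      dsimp only
      rw [add_assoc, ← Pi.single_add]
      exact line_mem_twoBlocks hM c'.2 hp.1 (by positivity) (by omega)
    · intro b _
      calc _ ≤ (Finset.range M).card :=
            Finset.card_le_card_of_injOn (fun q => q.2.2) ?_ ?_
        _ = M := Finset.card_range M
      · intro q hq
        simp only [Finset.coe_filter, Finset.mem_sigma, Finset.mem_product, Set.mem_setOf_eq] at hq
        exact Finset.mem_coe.2 hq.1.2.2
      · intro q hq q' hq' h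
        simp only [Finset.coe_filter, Finset.mem_sigma, Finset.mem_product, Set.mem_setOf_eq,
          mem_blockSites_iff] at hq hq'
        have h' : q.2.2 = q'.2.2 := h
        obtain ⟨h1, h2⟩ := Prod.ext_iff.1 (hq.2.trans hq'.2.symm)
        dsimp only at h1 h2
        rw [h', h2] at h1
        have hp1 : q.2.1 = q'.2.1 := add_right_cancel h1
        have hc1 : q.1 = q'.1 := Prod.ext (by rw [← hq.1.2.1, ← hq'.1.2.1, hp1]) h2
        exact Sigma.ext hc1 (heq_of_eq (Prod.ext hp1 h'))
  calc Qdd K (Qav M f) c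
      = ((K : ℝ) ^ d)⁻¹ * (((M : ℝ) ^ (d + 1))⁻¹ *
          ∑ c' ∈ qppBonds K c, ∑ p ∈ blockSites M c'.1 ×ˢ Finset.range M,
            f (p.1 + Pi.single c'.2 (p.2 : ℤ), c'.2)) := by
        rw [Qdd_apply']; simp_rw [Qav_apply_prod, ← Finset.mul_sum]
    _ ≤ ((K : ℝ) ^ d)⁻¹ * (((M : ℝ) ^ (d + 1))⁻¹ * (M * ∑ b ∈ qppBonds (M * K) c, f b)) := by
        gcongr
    _ = Qdd (M * K) f c := by
        rw [inv_pow_succ_mul _ hMr, ← mul_assoc, mul_comm (((K : ℝ) ^ d)⁻¹), ← mul_inv, ← mul_pow,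
          Qdd_apply', Nat.cast_mul M K]

/-- (142), p. 39 [PDF 23]: `Q″Q″_j|A| ≦ 2dQ″_{j+1}|A|` (a fine bond `b` whose scale-`M` block index is `w` is
counted only from the unit bonds `c' = (w, ν)` and `(w − e_ν, ν)`, `ν = 1, …, d`; weights
`K^{-d} · M^{-d} = (MK)^{-d}`) — field `OpFacts.q''q''`. [cite: Balaban1985Averaging, (142) p.39] -/
theorem Qdd_Qdd_le (M K : ℕ) (hM : 0 < M) (hK : 0 < K) {f : ZdEdge d → ℝ} (hf : 0 ≤ f) :
    Qdd K (Qdd M f) ≤ (2 * (d : ℝ)) • Qdd (M * K) f := by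
  haveI : NeZero M := ⟨hM.ne'⟩
  haveI : NeZero K := ⟨hK.ne'⟩
  intro c
  have key : ∑ c' ∈ qppBonds K c, ∑ b ∈ qppBonds M c', f b ≤ (2 * d : ℕ) * ∑ b ∈ qppBonds (M * K) c, f b := by
    have h := sum_sum_le_card_mul_sum (qppBonds K c) (fun c' => qppBonds M c') (fun _ b => b)
      (qppBonds (M * K) c) f (2 * d)
    refine h ?_ ?_ (fun b _ => hf b)
    · intro c' hc' b hb
      rw [mem_qppBonds] at hc'
      exact qppBonds_subset_mul hM hK hc'.1 hc'.2 hb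
    · intro b _
      set w := blockMap M b.1 with hw
      calc _ ≤ (Finset.univ : Finset (Fin d × Bool)).card :=
            Finset.card_le_card_of_injOn (fun q => (q.1.2, decide (q.1.1 = w))) (fun q _ => by simp) ?_
        _ = 2 * d := by
            rw [Finset.card_univ, Fintype.card_prod, Fintype.card_fin, Fintype.card_bool, mul_comm]
      intro q hq q' hq' h
      simp only [Finset.coe_filter, Finset.mem_sigma, Set.mem_setOf_eq] at hq hq'
      have h' : (q.1.2, decide (q.1.1 = w)) = (q'.1.2, decide (q'.1.1 = w)) := h
      obtain ⟨hν, hdec⟩ := Prod.ext_iff.1 h'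
      dsimp only at hν hdec
      -- the endpoint `b₋` of `b = q.2 = q'.2` has block index `w ∈ {c'₋, c'₋ + e_ν}` for both `c'`
      have hwq : w = q.1.1 ∨ w = q.1.1 + Pi.single q.1.2 1 := by
        have := ((mem_qppBonds M).1 hq.1.2).1
        rw [mem_twoBlocks_iff, hq.2] at this
        exact this
      have hwq' : w = q'.1.1 ∨ w = q'.1.1 + Pi.single q'.1.2 1 := by
        have := ((mem_qppBonds M).1 hq'.1.2).1
        rw [mem_twoBlocks_iff, hq'.2] at this
        exact this
      have hc1 : q.1.1 = q'.1.1 := by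
        by_cases e1 : q.1.1 = w
        · by_cases e2 : q'.1.1 = w
          · rw [e1, e2]
          · simp [e1, e2] at hdec
        · by_cases e2 : q'.1.1 = w
          · simp [e1, e2] at hdec
          · have a1 : w = q.1.1 + Pi.single q.1.2 1 := hwq.resolve_left (Ne.symm e1)
            have a2 : w = q'.1.1 + Pi.single q'.1.2 1 := hwq'.resolve_left (Ne.symm e2)
            rw [hν] at a1
            exact add_right_cancel (a1.symm.trans a2)
      exact Sigma.ext (Prod.ext hc1 hν) (heq_of_eq (hq.2.trans hq'.2.symm))
  calc Qdd K (Qdd M f) c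
      = ((K : ℝ) ^ d)⁻¹ * (((M : ℝ) ^ d)⁻¹ * ∑ c' ∈ qppBonds K c, ∑ b ∈ qppBonds M c', f b) := by
        rw [Qdd_apply']; simp_rw [Qdd_apply', ← Finset.mul_sum]
    _ ≤ ((K : ℝ) ^ d)⁻¹ * (((M : ℝ) ^ d)⁻¹ * ((2 * d : ℕ) * ∑ b ∈ qppBonds (M * K) c, f b)) := by
        gcongr
    _ = ((2 * (d : ℝ)) • Qdd (M * K) f) c := by
        rw [Pi.smul_apply, smul_eq_mul, Qdd_apply', Nat.cast_mul M K, mul_pow, mul_inv]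
        push_cast
        ring

/-- A fibre fact for `QQ″_j`: if `b ⊂ B^j(c'₋) ∪ B^j(c'₊)` for the bond `c' = (x + l e_μ, μ)` and `w` is the
scale-`M` block index of `b₋`, then `w − x = l e_μ` or `(l+1) e_μ`. [folklore] -/
private theorem fibre_aux {M : ℕ} [NeZero M] {x w : Fin d → ℤ} {μ : Fin d} {l : ℤ} {b : ZdEdge d}
    (hb : b ∈ qppBonds M (x + Pi.single μ l, μ)) (hw : blockMap M b.1 = w) :
    (w μ - x μ = l ∨ w μ - x μ = l + 1) ∧ ∀ i, i ≠ μ → w i = x i := by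
  rw [mem_qppBonds] at hb
  have h := (mem_twoBlocks_iff M).1 hb.1
  dsimp only at h
  rw [hw, add_assoc, ← Pi.single_add] at h
  rcases h with h | h
  · refine ⟨Or.inl ?_, fun i hi => ?_⟩
    · have := congr_fun h μ
      simp only [Pi.add_apply, Pi.single_eq_same] at this
      linarith
    · have := congr_fun h i
      simpa only [Pi.add_apply, Pi.single_eq_of_ne hi, add_zero] using this
  · refine ⟨Or.inr ?_, fun i hi => ?_⟩
    · have := congr_fun h μ
      simp only [Pi.add_apply, Pi.single_eq_same] at this
      linarith
    · have := congr_fun h i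
      simpa only [Pi.add_apply, Pi.single_eq_of_ne hi, add_zero] using this

/-- p. 40 [PDF 24] l. 9: `QQ″_j|A| ≦ 2Q″_{j+1}|A|`, in the SHARP form `QQ″_j|A| ≦ (2 − L⁻¹)Q″_{j+1}|A|` that
line 2 of (154) uses: a fine bond `b` with scale-`M` block index `w` is counted from the pairs `(x, l)`
(`x ∈ B(c₋)`, `l < K`) with `x = w − l e_μ` or `x = w − (l+1) e_μ`; of these `2K` candidates, `(w, 0)` and
`(w − K e_μ, K − 1)` are not both admissible (`w` and `w − K e_μ` lie in different `K`-blocks), so the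
multiplicity is `≤ 2K − 1`, and `(2K − 1) · K^{-(d+1)} · M^{-d} = (2 − K⁻¹)(MK)^{-d}` — field `OpFacts.qq''`.
[cite: Balaban1985Averaging, p.40 l.9, (154) p.41] -/
theorem Qav_Qdd_le (M K : ℕ) (hM : 0 < M) (hK : 0 < K) {f : ZdEdge d → ℝ} (hf : 0 ≤ f) :
    Qav K (Qdd M f) ≤ (2 - (K : ℝ)⁻¹) • Qdd (M * K) f := by
  haveI : NeZero M := ⟨hM.ne'⟩
  haveI : NeZero K := ⟨hK.ne'⟩
  have hKr : (K : ℝ) ≠ 0 := by exact_mod_cast hK.ne'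
  intro c
  obtain ⟨y, μ⟩ := c
  have key : ∑ a ∈ blockSites K y ×ˢ Finset.range K,
      ∑ b ∈ qppBonds M (a.1 + Pi.single μ (a.2 : ℤ), μ), f b
        ≤ (2 * K - 1 : ℕ) * ∑ b ∈ qppBonds (M * K) (y, μ), f b := by
    have h := sum_sum_le_card_mul_sum (blockSites K y ×ˢ Finset.range K)
      (fun a => qppBonds M (a.1 + Pi.single μ (a.2 : ℤ), μ)) (fun _ b => b) (qppBonds (M * K) (y, μ)) f
      (2 * K - 1)
    refine h ?_ ?_ (fun b _ => hf b)
    · intro a ha b hb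
      rw [Finset.mem_product, Finset.mem_range] at ha
      refine qppBonds_subset_mul hM hK ?_ ?_ hb
      · exact line_mem_twoBlocks hK μ ha.1 (by positivity) (by exact_mod_cast ha.2.le)
      · dsimp only
        rw [add_assoc, ← Pi.single_add]
        exact line_mem_twoBlocks hK μ ha.1 (by positivity) (by omega)
    · intro b _
      -- `w` := the scale-`M` block index of `b₋`
      obtain ⟨w, hw⟩ : ∃ w, blockMap M b.1 = w := ⟨_, rfl⟩
      -- the key `(w_μ − x_μ) + l ∈ {2l, 2l+1}` determines the pair `(x, l)`
      have inj : Set.InjOn (fun q : (_ : (Fin d → ℤ) × ℕ) × ZdEdge d => w μ - q.1.1 μ + q.1.2)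
          ↑(((blockSites K y ×ˢ Finset.range K).sigma
              fun a => qppBonds M (a.1 + Pi.single μ (a.2 : ℤ), μ)).filter fun p => p.2 = b) := by
        intro q hq q' hq' h
        simp only [Finset.coe_filter, Finset.mem_sigma, Finset.mem_product, Finset.mem_range,
          Set.mem_setOf_eq] at hq hq'
        have h' : w μ - q.1.1 μ + q.1.2 = w μ - q'.1.1 μ + q'.1.2 := h
        obtain ⟨hs, hrest⟩ := fibre_aux (w := w) hq.1.2 (by rw [hq.2]; exact hw)
        obtain ⟨hs', hrest'⟩ := fibre_aux (w := w) hq'.1.2 (by rw [hq'.2]; exact hw)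
        have hl : (q.1.2 : ℤ) = q'.1.2 := by omega
        have hxμ : q.1.1 μ = q'.1.1 μ := by omega
        have hx : q.1.1 = q'.1.1 := by
          funext i
          by_cases hi : i = μ
          · rw [hi, hxμ]
          · rw [← hrest i hi, ← hrest' i hi]
        exact Sigma.ext (Prod.ext hx (by exact_mod_cast hl)) (heq_of_eq (hq.2.trans hq'.2.symm))
      by_cases hwB : w ∈ blockSites K y
      · -- `w ∈ B(y)`: the candidate `(w − K e_μ, K − 1)` is excluded, keys lie in `[0, 2K − 1)`
        calc _ ≤ (Finset.Ico (0 : ℤ) ((2 * K - 1 : ℕ) : ℤ)).card :=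
              Finset.card_le_card_of_injOn _ ?_ inj
          _ = 2 * K - 1 := by rw [Int.card_Ico]; omega
        intro q hq
        simp only [Finset.coe_filter, Finset.mem_sigma, Finset.mem_product, Finset.mem_range,
          Set.mem_setOf_eq] at hq
        simp only [Finset.coe_Ico, Set.mem_Ico]
        obtain ⟨hs, hrest⟩ := fibre_aux (w := w) hq.1.2 (by rw [hq.2]; exact hw)
        have hlK : q.1.2 < K := hq.1.1.2
        refine ⟨by omega, ?_⟩
        -- exclude the key `2K − 1`: it forces `q.1.1 = w − K e_μ ∈ B(y)` while `w ∈ B(y)`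
        by_contra hge
        have hl : (q.1.2 : ℤ) = K - 1 := by push_cast [Nat.cast_sub (by omega : 1 ≤ 2 * K)] at hge; omega
        have hsK : w μ - q.1.1 μ = K := by push_cast [Nat.cast_sub (by omega : 1 ≤ 2 * K)] at hge; omega
        have hwx : w = q.1.1 + Pi.single μ ((K : ℤ) * 1) := by
          funext i
          by_cases hi : i = μ
          · rw [hi, Pi.add_apply, Pi.single_eq_same]; omega
          · rw [Pi.add_apply, Pi.single_eq_of_ne hi, add_zero]; exact hrest i hi
        have h1 := (mem_blockSites_iff K y w).1 hwB
        have h2 := (mem_blockSites_iff K y _).1 hq.1.1.1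
        rw [hwx, blockMap_add_single_mul K hK.ne', h2] at h1
        have := congr_fun h1 μ
        simp only [Pi.add_apply, Pi.single_eq_same] at this
        omega
      · -- `w ∉ B(y)`: the candidate `(w, 0)` is excluded, keys lie in `[1, 2K)`
        calc _ ≤ (Finset.Ico (1 : ℤ) (1 + ((2 * K - 1 : ℕ) : ℤ))).card :=
              Finset.card_le_card_of_injOn _ ?_ inj
          _ = 2 * K - 1 := by rw [Int.card_Ico]; omega
        intro q hq
        simp only [Finset.coe_filter, Finset.mem_sigma, Finset.mem_product, Finset.mem_range,
          Set.mem_setOf_eq] at hq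
        simp only [Finset.coe_Ico, Set.mem_Ico]
        obtain ⟨hs, hrest⟩ := fibre_aux (w := w) hq.1.2 (by rw [hq.2]; exact hw)
        have hlK : q.1.2 < K := hq.1.1.2
        refine ⟨?_, by push_cast [Nat.cast_sub (by omega : 1 ≤ 2 * K)]; omega⟩
        -- exclude the key `0`: it forces `q.1.1 = w`, contradicting `w ∉ B(y)`
        by_contra hlt
        have hl : (q.1.2 : ℤ) = 0 := by omega
        have hs0 : w μ - q.1.1 μ = 0 := by omega
        have hwx : w = q.1.1 := by
          funext i
          by_cases hi : i = μ
          · rw [hi]; omega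
          · exact hrest i hi
        exact hwB (by rw [hwx]; exact hq.1.1.1)
  have h2K : ((2 * K - 1 : ℕ) : ℝ) = 2 * (K : ℝ) - 1 := by
    rw [Nat.cast_sub (by omega), Nat.cast_mul]; norm_num
  calc Qav K (Qdd M f) (y, μ)
      = ((K : ℝ) ^ (d + 1))⁻¹ * (((M : ℝ) ^ d)⁻¹ *
          ∑ a ∈ blockSites K y ×ˢ Finset.range K,
            ∑ b ∈ qppBonds M (a.1 + Pi.single μ (a.2 : ℤ), μ), f b) := by
        rw [Qav_apply_prod]; simp_rw [Qdd_apply', ← Finset.mul_sum]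
    _ ≤ ((K : ℝ) ^ (d + 1))⁻¹ * (((M : ℝ) ^ d)⁻¹ *
          ((2 * K - 1 : ℕ) * ∑ b ∈ qppBonds (M * K) (y, μ), f b)) := by
        gcongr
    _ = ((2 - (K : ℝ)⁻¹) • Qdd (M * K) f) (y, μ) := by
        rw [Pi.smul_apply, smul_eq_mul, Qdd_apply', Nat.cast_mul M K, h2K, pow_succ, mul_inv, mul_pow,
          mul_inv]
        linear_combination (2 * ((K : ℝ) ^ d)⁻¹ * ((M : ℝ) ^ d)⁻¹ *
          ∑ b ∈ qppBonds (M * K) (y, μ), f b) * inv_mul_cancel₀ hKr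

/-! ## 5. `B7Prop5Induction.OpFacts` discharged on the lattice -/

/-- `OpFacts` is monotone in the constant `κ` (its only `κ`-field is `QQ″_j f ≤ κ • Q″_{j+1} f` with
`Q″_{j+1} f ≥ 0`). [folklore] -/
theorem opFacts_of_kappa_le {B₀ B₁ B₂ : Type*} {dd κ κ' : ℝ} {Qj Qj'' : (B₀ → ℝ) →ₗ[ℝ] (B₁ → ℝ)}
    {Q Q'' : (B₁ → ℝ) →ₗ[ℝ] (B₂ → ℝ)} {Qj1 Qj1'' : (B₀ → ℝ) →ₗ[ℝ] (B₂ → ℝ)}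
    (h : OpFacts dd κ Qj Qj'' Q Q'' Qj1 Qj1'') (hκ : κ ≤ κ') : OpFacts dd κ' Qj Qj'' Q Q'' Qj1 Qj1'' where
  monoQj := h.monoQj
  monoQj'' := h.monoQj''
  monoQ := h.monoQ
  monoQ'' := h.monoQ''
  monoQj1 := h.monoQj1
  monoQj1'' := h.monoQj1''
  qq := h.qq
  qq'' f hf := (h.qq'' f hf).trans fun c => by
    simp only [Pi.smul_apply, smul_eq_mul]
    exact mul_le_mul_of_nonneg_right hκ (apply_nonneg _ h.monoQj1'' hf c)
  q''q := h.q''q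
  q''q'' := h.q''q''
  qj_le_sup := h.qj_le_sup
  qj''_le_sup := h.qj''_le_sup

/-- THE DISCHARGE.  For every integer `L ≥ 1` and every `j`, the six printed operators
`Q_j = Qav (L^j)`, `Q″_j = Qdd (L^j)`, `Q = Qav L`, `Q″ = Qdd L`, `Q_{j+1} = Qav (L^(j+1))`,
`Q″_{j+1} = Qdd (L^(j+1))` on the bonds of `ℤ^d` satisfy EVERY field of `B7Prop5Induction.OpFacts` with the
sharp constant `κ = 2 − L⁻¹` of (154): monotonicity, "a composition of k operators Q is Q_k", p. 40 l. 9
(both inequalities), (142), `Q_j 1 = 1`, `Q″_j 1 ≤ 2d`.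
[cite: Balaban1985Averaging, (139)-(142) p.39, p.40 l.9] -/
theorem opFacts_lattice (L : ℕ) (hL : 0 < L) (j : ℕ) :
    OpFacts (d : ℝ) (2 - (L : ℝ)⁻¹) (Qav (d := d) (L ^ j)) (Qdd (L ^ j)) (Qav L) (Qdd L)
      (Qav (L ^ (j + 1))) (Qdd (L ^ (j + 1))) where
  monoQj := Qav_monotone _
  monoQj'' := Qdd_monotone _
  monoQ := Qav_monotone _
  monoQ'' := Qdd_monotone _
  monoQj1 := Qav_monotone _
  monoQj1'' := Qdd_monotone _
  qq f _ := by rw [pow_succ, Qav_Qav (L ^ j) L (pow_pos hL j) hL f]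
  qq'' f hf := by rw [pow_succ]; exact Qav_Qdd_le (L ^ j) L (pow_pos hL j) hL hf
  q''q f hf := by rw [pow_succ]; exact Qdd_Qav_le (L ^ j) L (pow_pos hL j) hL hf
  q''q'' f hf := by rw [pow_succ]; exact Qdd_Qdd_le (L ^ j) L (pow_pos hL j) hL hf
  qj_le_sup f a _ hf c := Qav_le_of_le (L ^ j) (pow_pos hL j) hf c
  qj''_le_sup f a ha hf c := Qdd_le_of_le (L ^ j) (pow_pos hL j) ha hf c

/-- The same with the printed constant `κ = 2` of p. 40 (`QQ″_j|A| ≦ 2Q″_{j+1}|A|`), the shape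
`B7Prop5Induction.ineq143_succ` takes. [cite: Balaban1985Averaging, p.40 l.9] -/
theorem opFacts_lattice_two (L : ℕ) (hL : 0 < L) (j : ℕ) :
    OpFacts (d : ℝ) 2 (Qav (d := d) (L ^ j)) (Qdd (L ^ j)) (Qav L) (Qdd L)
      (Qav (L ^ (j + 1))) (Qdd (L ^ (j + 1))) :=
  opFacts_of_kappa_le (opFacts_lattice L hL j) (by
    have : (0 : ℝ) ≤ (L : ℝ)⁻¹ := inv_nonneg.2 (Nat.cast_nonneg L)
    linarith)

/-- The hypothesis `hQk : ∀ f ≥ 0, Q_k f ≤ Q″_k f` of `B7Prop5Induction.ineq146` ((146), second step), on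
the lattice. [cite: Balaban1985Averaging, (146) p.40] -/
theorem qk_le_qddk (L : ℕ) (hL : 0 < L) (k : ℕ) :
    ∀ f : ZdEdge d → ℝ, 0 ≤ f → Qav (L ^ k) f ≤ Qdd (L ^ k) f :=
  fun _ hf => Qav_le_Qdd (L ^ k) (pow_pos hL k) hf

/-! ## 6. By-name composition with the sibling `B7Prop5Induction`

The three induction steps of the sibling, with their `OpFacts` / `hQk` hypotheses DISCHARGED on the
lattice; what remains hypothetical in each is exactly the analytic input of the print ((143)ⱼ, (139),
(148), (149)ⱼ, (135), (153) and the constants). -/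

open Literature.MathematicalPhysics.QuantumFieldTheory.Balaban1983to89.B7Prop5Induction
  (Hyp154 ineq143_succ ineq146 ineq149_succ)

/-- (143)ⱼ ⇒ (143)ⱼ₊₁ on the lattice: the sibling's `ineq143_succ` with `OpFacts d 2 …` supplied by
`opFacts_lattice_two`. [cite: Balaban1985Averaging, (143)-(145) p.40] -/
theorem ineq143_succ_lattice (L : ℕ) (hL : 2 ≤ L) (j : ℕ) {C₁' α₀ s : ℝ} (hC₁' : 0 ≤ C₁')
    (hα₀ : 0 ≤ α₀) (hs : 0 ≤ s) (hsL : s ≤ ((L : ℝ))⁻¹ ^ 2)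
    (h145 : 16 * (d : ℝ) * C₁' * ((L : ℝ))⁻¹ ^ 4 * α₀ ≤ 1)
    {nA : ZdEdge d → ℝ} (hnA : 0 ≤ nA) {qA qA1 : ZdEdge d → ℝ}
    (h143 : qA ≤ Qav (L ^ j) nA + (2 * C₁' * α₀ * s) • Qdd (L ^ j) nA)
    (h139 : qA1 ≤ Qav L qA + (2 * C₁' * α₀ * s) • Qdd L qA) :
    qA1 ≤ Qav (L ^ (j + 1)) nA + (2 * C₁' * α₀ * ((L : ℝ) ^ 2 * s)) • Qdd (L ^ (j + 1)) nA :=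
  ineq143_succ (opFacts_lattice_two L (by omega) j) (by exact_mod_cast hL) (Nat.cast_nonneg d) hC₁'
    hα₀ hs hsL h145 hnA h143 h139

/-- (146) on the lattice: the sibling's `ineq146` with `hQk` supplied by `qk_le_qddk`.
[cite: Balaban1985Averaging, (146) p.40] -/
theorem ineq146_lattice (L : ℕ) (hL : 0 < L) (k : ℕ) {C₁' α₀ : ℝ} {nA : ZdEdge d → ℝ}
    (hnA : 0 ≤ nA) {qA : ZdEdge d → ℝ}
    (h143k : qA ≤ Qav (L ^ k) nA + (2 * C₁' * α₀) • Qdd (L ^ k) nA) :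
    qA ≤ (1 + 2 * C₁' * α₀) • Qdd (L ^ k) nA :=
  ineq146 (qk_le_qddk L hL k) hnA h143k

/-- (149)ⱼ ⇒ (149)ⱼ₊₁ on the lattice ((154)–(155)): the sibling's `ineq149_succ` with
`OpFacts d (2 − L⁻¹) …` supplied by `opFacts_lattice`; `Hyp154` (the analytic data of the step) and
(155) stay hypotheses. [cite: Balaban1985Averaging, (149) p.40, (154)-(155) p.41] -/
theorem ineq149_succ_lattice (L : ℕ) (hL : 0 < L) (j : ℕ) {C₁' C₁'' C₂ C₃ α₀ α₁ s a p : ℝ}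
    {nA nδ qA qδ g cj r t₁ t₂ T : ZdEdge d → ℝ}
    (h : Hyp154 (L : ℝ) (d : ℝ) C₁' C₁'' C₂ C₃ α₀ α₁ s a p nA nδ qA qδ g cj r t₁ t₂ T
      (Qav (L ^ j)) (Qdd (L ^ j)) (Qav L) (Qdd L))
    (hC₃ : 0 < C₃)
    (h155 : 4 * (d : ℝ) * C₁' * α₀ * ((L : ℝ))⁻¹ + C₁'' / C₃ *
        (1 + 4 * (d : ℝ) * C₁' * α₀ * ((L : ℝ))⁻¹ ^ 2 + C₂ * ((L : ℝ))⁻¹ * α₁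
          + 2 * (d : ℝ) * C₃ * ((L : ℝ))⁻¹ * α₁) ^ 2 ≤ 1) :
    T ≤ (C₃ * a) • Qdd (L ^ (j + 1)) nδ :=
  ineq149_succ (opFacts_lattice L hL j) h hC₃ h155

end Literature.MathematicalPhysics.QuantumFieldTheory.Balaban1983to89.B7BlockGeometry
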